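import Summits.CriticalPhenomena.SAWScalingLimit.Theorems.SAWLeftRightFKGFKGToTraversalBoundBBFaceLocal
import Summits.CriticalPhenomena.SAWScalingLimit.Theorems.SAWLeftRightFKGFKGToTraversalBoundBoundaryBudget
import HarnessLib

/-!
# Face-chain discretisation, part 2: the non-`A` face corners along a path form a `4`-connected set

Crux `SAWLeftRightFKG.FKGToTraversalBound` (stmt-CriticalPhenomena-1878), line `slit-necklace`, lead
prover-line-stmt-CriticalPhenomena-1878-c5-0; wave 6 (boundary budget U6), unit BB4, part 2, on top of
`…BBFaceLocal` (`bbc_local`: the local lemma at one point; `bbc_corner_iff`).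

Registered stub `bb_face_chain` (DISCRETISATION of a continuum connector): let `A ⊆ ℤ²` be finite with no pinch
(no closed face whose `A`-corners are exactly a diagonal pair), `η > 0`, and let `π` be a continuous path in `ℂ`
avoiding the mesh points `meshPoint η f` of the sites `f ∈ A`, the closed segments between lattice-adjacent sites of
`A`, and the closed `η`-faces all four of whose corners lie in `A`.  Then the (finite) set `X` of all non-`A` corners
of closed `η`-faces met by `π` is `4`-connected (any two of its sites are joined by a nearest-neighbour walk inside
`X`); the last two conjuncts say that `X` is exactly this set.

Proof.  Finiteness: the range of `π` is bounded, so the corners lie in a bounded box of `ℤ²`.  Connectivity: by the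
local lemma, at each parameter `t` the non-`A` corners `Cor(π t)` of the faces through `π t` form a nonempty set,
connected inside itself, and `Cor(π t') ⊆ Cor(π t)` for `t'` near `t` (continuity of `π`); hence the relation
"every site of `Cor(π t)` is joined inside `X` to every site of `Cor(π t')`" holds for `t'` near `t` and is
transitive, so it holds for all `t, t'` by connectedness of the unit interval (`IsPreconnected.induction₂'`).

All statements folklore (elementary geometry of the square grid); no literature fact; nothing restates the crux.
-/

noncomputable section

open Filter Topology Set Metric SimpleGraph
open Literature.Probability.LatticeModels

namespace Summit.CriticalPhenomena.SAWScalingLimit.Theorems.FKGToTraversalBound.SlitNecklace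

/-- The corners of the closed `η`-faces containing a point of norm `≤ R` lie in a fixed bounded box of `ℤ²`.
[folklore] -/
theorem bbc_corner_mem_box {η R : ℝ} (hη : 0 < η) {p : ℂ} (hp : ‖p‖ ≤ R) {g z : Site 2}
    (hg : ((meshPoint η g).re ≤ p.re ∧ p.re ≤ (meshPoint η g).re + η ∧ (meshPoint η g).im ≤ p.im ∧ p.im ≤ (meshPoint η g).im + η))
    (hz : (z = g ∨ z = g + ODir.vec 0 ∨ z = g + ODir.vec 1 ∨ z = g + ODir.vec 0 + ODir.vec 1)) :
    z ∈ Set.pi Set.univ (fun _ : Fin 2 => Set.Icc ⌊-(R / η) - 1⌋ ⌈R / η + 1⌉) := by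
  have hre := abs_le.1 ((Complex.abs_re_le_norm p).trans hp)
  have him := abs_le.1 ((Complex.abs_im_le_norm p).trans hp)
  simp only [meshPoint_re, meshPoint_im] at hg
  rw [bbc_corner_iff] at hz
  have key : ∀ (k c : ℤ) (a : ℝ), -R ≤ a → a ≤ R → η * k ≤ a → a ≤ η * k + η → (c = k ∨ c = k + 1) →
      c ∈ Set.Icc ⌊-(R / η) - 1⌋ ⌈R / η + 1⌉ := by
    intro k c a ha1 ha2 h1 h2 hc
    have hk1 : (k : ℝ) ≤ R / η := by rw [le_div_iff₀ hη]; linarith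
    have hk2 : -R / η ≤ k + 1 := by rw [div_le_iff₀ hη]; linarith
    rw [neg_div] at hk2
    have hc' : (k : ℝ) ≤ c ∧ (c : ℝ) ≤ k + 1 := by
      rcases hc with rfl | rfl <;> push_cast <;> constructor <;> linarith
    refine ⟨Int.cast_le.1 ((Int.floor_le _).trans ?_), Int.cast_le.1 (le_trans ?_ (Int.le_ceil _))⟩
    · linarith
    · linarith
  exact Set.mem_univ_pi.2 fun i => by
    fin_cases i
    · exact key (g 0) (z 0) p.re hre.1 hre.2 hg.1 hg.2.1 hz.1
    · exact key (g 1) (z 1) p.im him.1 him.2 hg.2.2.1 hg.2.2.2 hz.2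

/-- **Registered stub `bb_face_chain` (U6 BB4: discretisation of a continuum path into a `4`-connected lattice
connector of non-`A` face corners).**  For a finite pinch-free site set `A`, a mesh `η > 0` and a continuous path
`π` avoiding the mesh points of `A`, the closed segments between lattice-adjacent `A`-sites and the closed full
squares of `A`, the set `X` of all non-`A` corners of closed `η`-faces met by `π` is a finite `4`-connected subset of
the complement of `A`, containing every such corner and nothing else. [folklore] -/
theorem bb_face_chain : ∀ (A : Finset (Site 2)) (η : ℝ) {u v : ℂ} (π : Path u v), 0 < η → (∀ f : Site 2, (f ∈ A → f + ODir.vec 0 + ODir.vec 1 ∈ A → f + ODir.vec 0 ∈ A ∨ f + ODir.vec 1 ∈ A) ∧ (f + ODir.vec 0 ∈ A → f + ODir.vec 1 ∈ A → f ∈ A ∨ f + ODir.vec 0 + ODir.vec 1 ∈ A)) → (∀ t, ∀ f ∈ A, π t ≠ meshPoint η f) → (∀ t, ∀ f ∈ A, ∀ d : ODir, f + d.vec ∈ A → π t ∉ segment ℝ (meshPoint η f) (meshPoint η (f + d.vec))) → (∀ t, ∀ f : Site 2, f ∈ A → f + ODir.vec 0 ∈ A → f + ODir.vec 1 ∈ A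 → f + ODir.vec 0 + ODir.vec 1 ∈ A → ¬ ((meshPoint η f).re ≤ (π t).re ∧ (π t).re ≤ (meshPoint η f).re + η ∧ (meshPoint η f).im ≤ (π t).im ∧ (π t).im ≤ (meshPoint η f).im + η)) → ∃ X : Finset (Site 2), (∀ s ∈ X, s ∉ A) ∧ (∀ x ∈ X, ∀ x' ∈ X, ∃ w : (zdGraph 2).Walk x x', ∀ z ∈ w.support, z ∈ X) ∧ (∀ (g s : Site 2) (t : unitInterval), ((meshPoint η g).re ≤ (π t).re ∧ (π t).re ≤ (meshPoint η g).re + η ∧ (meshPoint η g).im ≤ (π t).im ∧ (π t).im ≤ (meshPoint η g).im + η) → (s = g ∨ s = g + ODir.vec 0 ∨ s = g + ODir.vec 1 ∨ s = g + ODir.vec 0 + ODir.vec 1) → s ∉ A → s ∈ X) ∧ (∀ s ∈ X, ∃ (g : Site 2) (t : unitInterval), ((meshPoint η g).re ≤ (π t).re ∧ (π t).re ≤ (meshPoint η g).re + η ∧ (meshPoint η g).im ≤ (π t).im ∧ (π t).im ≤ (meshPoint η g).im + η) ∧ (s = g ∨ s = g + ODir.vec 0 ∨ s = g + ODir.vec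 1 ∨ s = g + ODir.vec 0 + ODir.vec 1)) := by
  intro A η u v π hη hpinch hpt hseg hsq
  obtain ⟨R, hR⟩ := (isCompact_range π.continuous).isBounded.subset_closedBall 0
  have hnorm : ∀ t, ‖π t‖ ≤ R := fun t => by
    have h := hR ⟨t, rfl⟩
    rwa [Metric.mem_closedBall, dist_zero_right] at h
  -- the set of non-`A` corners of closed faces met by `π`
  set SX : Set (Site 2) :=
    {z | z ∉ A ∧ ∃ (g : Site 2) (t : unitInterval), ((meshPoint η g).re ≤ (π t).re ∧ (π t).re ≤ (meshPoint η g).re + η ∧ (meshPoint η g).im ≤ (π t).im ∧ (π t).im ≤ (meshPoint η g).im + η) ∧ (z = g ∨ z = g + ODir.vec 0 ∨ z = g + ODir.vec 1 ∨ z = g + ODir.vec 0 + ODir.vec 1)}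
    with hSX
  have hfin : SX.Finite := by
    refine (Set.Finite.pi (t := fun _ : Fin 2 => Set.Icc ⌊-(R / η) - 1⌋ ⌈R / η + 1⌉)
      fun _ => Set.finite_Icc _ _).subset ?_
    rintro z ⟨-, g, t, hg, hz⟩
    exact bbc_corner_mem_box hη (hnorm t) hg hz
  -- chaining along the path, by connectedness of the unit interval
  have hchain : ∀ t t' : unitInterval, ∀ (g s g' s' : Site 2), ((meshPoint η g).re ≤ (π t).re ∧ (π t).re ≤ (meshPoint η g).re + η ∧ (meshPoint η g).im ≤ (π t).im ∧ (π t).im ≤ (meshPoint η g).im + η) → (s = g ∨ s = g + ODir.vec 0 ∨ s = g + ODir.vec 1 ∨ s = g + ODir.vec 0 + ODir.vec 1) → s ∉ A → ((meshPoint η g').re ≤ (π t').re ∧ (π t').re ≤ (meshPoint η g').re + η ∧ (meshPoint η g').im ≤ (π t').im ∧ (π t').im ≤ (meshPoint η g').im + η) → (s' = g' ∨ s' = g' + ODir.vec 0 ∨ s' = g' + ODir.vec 1 ∨ s' = g' + ODir.vec 0 + ODir.vec 1) → s' ∉ A → ∃ w : (zdGraph 2).Walk s s', ∀ z ∈ w.support,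 z ∈ SX := by
    intro t t'
    refine (isPreconnected_univ (α := unitInterval)).induction₂'
      (fun t t' : unitInterval => ∀ (g s g' s' : Site 2), ((meshPoint η g).re ≤ (π t).re ∧ (π t).re ≤ (meshPoint η g).re + η ∧ (meshPoint η g).im ≤ (π t).im ∧ (π t).im ≤ (meshPoint η g).im + η) → (s = g ∨ s = g + ODir.vec 0 ∨ s = g + ODir.vec 1 ∨ s = g + ODir.vec 0 + ODir.vec 1) → s ∉ A → ((meshPoint η g').re ≤ (π t').re ∧ (π t').re ≤ (meshPoint η g').re + η ∧ (meshPoint η g').im ≤ (π t').im ∧ (π t').im ≤ (meshPoint η g').im + η) → (s' = g' ∨ s' = g' + ODir.vec 0 ∨ s' = g' + ODir.vec 1 ∨ s' = g' + ODir.vec 0 + ODir.vec 1) → s' ∉ A → ∃ w : (zdGraph 2).Walk s s', ∀ z ∈ w.support, z ∈ SX)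
      ?_ ?_ (mem_univ t) (mem_univ t')
    · -- near `x`: the faces through `π y` are faces through `π x`
      intro x _
      rw [nhdsWithin_univ]
      obtain ⟨-, hconn, ε, hε, hloc⟩ := bbc_local A η (π x) hη hpinch (hpt x) (hseg x) (hsq x)
      filter_upwards [Metric.tendsto_nhds.1 (π.continuous.tendsto x) ε hε] with y hy
      refine ⟨fun g s g' s' hg hs hsA hg' hs' hs'A => ?_, fun g s g' s' hg hs hsA hg' hs' hs'A => ?_⟩
      · obtain ⟨w, hw⟩ := hconn g s g' s' hg hs hsA (hloc _ hy g' hg') hs' hs'A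
        refine ⟨w, fun z hz => ⟨(hw z hz).1, ?_⟩⟩
        obtain ⟨g'', h1, h2⟩ := (hw z hz).2
        exact ⟨g'', x, h1, h2⟩
      · obtain ⟨w, hw⟩ := hconn g s g' s' (hloc _ hy g hg) hs hsA hg' hs' hs'A
        refine ⟨w, fun z hz => ⟨(hw z hz).1, ?_⟩⟩
        obtain ⟨g'', h1, h2⟩ := (hw z hz).2
        exact ⟨g'', x, h1, h2⟩
    · -- transitivity, through a non-`A` corner of a face through `π y`
      intro x y z _ _ _ hxy hyz g s g' s' hg hs hsA hg' hs' hs'A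
      obtain ⟨⟨g₁, s₁, hg₁, hs₁, hs₁A⟩, -, -⟩ := bbc_local A η (π y) hη hpinch (hpt y) (hseg y) (hsq y)
      obtain ⟨w₁, hw₁⟩ := hxy g s g₁ s₁ hg hs hsA hg₁ hs₁ hs₁A
      obtain ⟨w₂, hw₂⟩ := hyz g₁ s₁ g' s' hg₁ hs₁ hs₁A hg' hs' hs'A
      refine ⟨w₁.append w₂, fun z hz => ?_⟩
      rcases (Walk.mem_support_append_iff _ _).1 hz with hz | hz
      exacts [hw₁ z hz, hw₂ z hz]
  refine ⟨hfin.toFinset, fun s hs => (hfin.mem_toFinset.1 hs).1, fun x hx x' hx' => ?_,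
    fun g s t hg hs hsA => hfin.mem_toFinset.2 ⟨hsA, g, t, hg, hs⟩, fun s hs => ?_⟩
  · obtain ⟨hxA, g, t, hg, hc⟩ := hfin.mem_toFinset.1 hx
    obtain ⟨hxA', g', t', hg', hc'⟩ := hfin.mem_toFinset.1 hx'
    obtain ⟨w, hw⟩ := hchain t t' g x g' x' hg hc hxA hg' hc' hxA'
    exact ⟨w, fun z hz => hfin.mem_toFinset.2 (hw z hz)⟩
  · obtain ⟨-, g, t, hg, hc⟩ := hfin.mem_toFinset.1 hs
    exact ⟨g, t, hg, hc⟩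

end Summit.CriticalPhenomena.SAWScalingLimit.Theorems.FKGToTraversalBound.SlitNecklace

end
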